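import Literature.AlgebraicGeometry.Motives.ChowConeClosure
import Literature.Geometry.Kaehler.AnalyticSetProofs
import HarnessLib

/-!
# Chow's theorem, Remmert–Stein at the vertex of a cone, III: the decomposition of the cone

Family `hodge` (**hodge.S17**, Chow's theorem), layer `Literature/AlgebraicGeometry/Motives`.
Continuation of `ChowConeLocal.lean`, `ChowConeClosure.lean` (same setting: `Z ⊆ ℂᵈ × ℂᵐ⁺¹`
closed, stable under all scalars, cut out by holomorphic equations near every point `≠ 0`,
isolating fibre space; `G` the unramified part of the projection `π (z', w) = z'`, characterised
by `hG`).

Let `Z₁ = cl {x ∈ Z | π x ∈ G}` (cut out by holomorphic equations everywhere, vertex included: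
`isZeroSetAt_closure_good`). Here we prove the **decomposition**
`exists_cone_decomposition`:

> `Z = Z₁ ∪ Z₂` with `Z₂ ⊆ Z` a closed cone, cut out by holomorphic equations near every point
> `≠ 0`, all of whose points lie over the complement of `G`.

Since `G` is a non-empty open cone of `ℂᵈ`, `Z₂` meets the subspace `π⁻¹(ℂ z'₁)`, `z'₁ ∈ G`, only
at the vertex — an isolating subspace of smaller codimension than `{0} × ℂᵐ⁺¹` — which is what
drives the induction of `ChowConeChow.lean`.

`Z₂` is the closure of the union `S₂` of those connected components of the regular locus of
`Z ∖ {0}` which do not meet `π⁻¹(G)`, plus the vertex; it is analytic off the vertex by the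
closure theorem for unions of components of the regular locus
(`Literature.Geometry.Kaehler.SCV.RegData.isZeroSetAt_closure`, [Chirka1989, §5.1 Thm. (2)]).
That `Z ⊆ Z₁ ∪ Z₂` rests on the density of regular points
(`Literature.Geometry.Kaehler.IsAnalyticSetAt.inter_regularLocus_nonempty`), constancy of the
codimension along components, and the key lemma `mem_closure_good_of_isRegPt`: **a regular point
of `Z ∖ {0}` of codimension `m + 1` lies in `Z₁`** — near it `Z` is a `d`-dimensional complex
manifold on which `π` has finite fibres, so `π` is open at some point of any neighbourhood
(`Literature.Geometry.Kaehler.SCV.exists_map_nhds_eq_of_isolated`, a Sard-free "finite maps are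
open somewhere"), and the discriminant `Δ ≢ 0` of `exists_thin_of_good` cannot vanish on an open
set. Points of `Z` over `G` are regular of codimension `m + 1` (`isRegPt_of_fst_mem_good`).
[Chirka1989, §4.4 (proof of the Remmert–Stein theorem: "`π|_A` is locally biholomorphic … hence
`br π|_A` is nowhere dense in `A`"), §5.1; Mumford1981, §4A (4.7).]

## References

* [Chirka1989] E. M. Chirka, *Complex Analytic Sets*, Kluwer (1989), §2.3, §4.4, §5.1.
* [Mumford1981] D. Mumford, *Algebraic Geometry I: Complex Projective Varieties*, §4A (4.7).
-/

noncomputable section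

open scoped Topology Manifold
open Set Filter Metric Function
open Literature.Analysis.Complex.SCV (IsZeroSetAt isZeroSetAt_iff_isAnalyticSetAt)
open Literature.Geometry.Kaehler.SCV (IsRegPt regLocus RegData regularLocus_eq_regLocus
  isRegularPointOfCodim_iff_isRegPt regLocus_image_equiv exists_map_nhds_eq_of_isolated)

namespace Literature.AlgebraicGeometry.Motives

/-! ### Model-space tools: parametrisation of regular points, density, codimension -/

section ModelTools

variable {E : Type*} [NormedAddCommGroup E] [NormedSpace ℂ E] [FiniteDimensional ℂ E]

/-- **Injective holomorphic parametrisation near a regular point** (holomorphic implicit function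
theorem, `Literature.Analysis.Complex.SCV.exists_straightening`; a variant of
`IsRegPt.exists_goodNhd` recording injectivity and the dimension of the parameter space): if `x ∈ Z`
is a regular point of codimension `p`, then inside any neighbourhood of `x` there is an open `N ∋ x`
such that `Z ∩ N` is the injective holomorphic image of a ball of a complex vector space of
dimension `dim E - p`. Declared in the namespace of `IsRegPt`.
[Chirka, *Complex Analytic Sets*, §2.3, A2.2] [folklore] -/
theorem _root_.Literature.Geometry.Kaehler.SCV.IsRegPt.exists_param {Z : Set E} {p : ℕ} {x : E}
    (h : IsRegPt Z p x) (hxZ : x ∈ Z) {N₀ : Set E} (hN₀ : N₀ ∈ 𝓝 x) :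
    ∃ (N : Set E) (K : Submodule ℂ E) (ρ : ℝ) (Ψ₀ : K → E), IsOpen N ∧ x ∈ N ∧ N ⊆ N₀ ∧ 0 < ρ ∧
      Module.finrank ℂ K + p = Module.finrank ℂ E ∧ DifferentiableOn ℂ Ψ₀ (ball 0 ρ) ∧
      InjOn Ψ₀ (ball 0 ρ) ∧ Ψ₀ '' ball 0 ρ = Z ∩ N := by
  obtain ⟨U, hU, hxU, g, hg, hZU, hsurj⟩ := h
  have hgx : g x = 0 := by
    have : x ∈ U ∩ g ⁻¹' {0} := hZU ▸ ⟨hxZ, hxU⟩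
    exact this.2
  obtain ⟨U₁, hU₁N, hU₁o, hxU₁⟩ := _root_.mem_nhds_iff.1 (Filter.inter_mem hN₀ (hU.mem_nhds hxU))
  have hU₁U : U₁ ⊆ U := fun y hy => (hU₁N hy).2
  have hg₁ : DifferentiableOn ℂ g U₁ := hg.mono hU₁U
  set K := LinearMap.ker ((fderiv ℂ g x : E →L[ℂ] (Fin p → ℂ)) : E →ₗ[ℂ] (Fin p → ℂ)) with hK
  -- dimension of the kernel
  have hdim : Module.finrank ℂ K + p = Module.finrank ℂ E := by
    have h1 := LinearMap.finrank_range_add_finrank_ker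
      ((fderiv ℂ g x : E →L[ℂ] (Fin p → ℂ)) : E →ₗ[ℂ] (Fin p → ℂ))
    have h2 : Module.finrank ℂ (LinearMap.range
        ((fderiv ℂ g x : E →L[ℂ] (Fin p → ℂ)) : E →ₗ[ℂ] (Fin p → ℂ))) = p := by
      rw [LinearMap.range_eq_top.2 hsurj, finrank_top, Module.finrank_fin_fun]
    rw [h2] at h1
    rw [← h1, add_comm]
  obtain ⟨ψ, hbij⟩ := Literature.Analysis.Complex.SCV.exists_proj_ker_bijective (fderiv ℂ g x) hsurj
  obtain ⟨S, T, Ψ, hSo, hxS, hSU, hTo, hΨd, hΦΨ, hΨΦ, -⟩ :=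
    Literature.Analysis.Complex.SCV.exists_straightening hg₁ hU₁o hxU₁ ψ hbij
  have hΦx : ((g x, ψ (x - x)) : (Fin p → ℂ) × K) = (0, 0) := by
    rw [hgx, sub_self, map_zero]
  have h0T : ((0, 0) : (Fin p → ℂ) × K) ∈ T := hΦx ▸ (hΦΨ x hxS).1
  obtain ⟨ρ, hρ, hρT⟩ := Metric.isOpen_iff.1 hTo _ h0T
  set N : Set E := S ∩ (fun z => ((g z, ψ (z - x)) : (Fin p → ℂ) × K)) ⁻¹' ball (0, 0) ρ with hN
  have hΦc : ContinuousOn (fun z => ((g z, ψ (z - x)) : (Fin p → ℂ) × K)) S :=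
    (hg₁.continuousOn.mono hSU).prodMk
      ((ψ.continuous.comp (continuous_id.sub continuous_const)).continuousOn)
  have hNo : IsOpen N := hΦc.isOpen_inter_preimage hSo isOpen_ball
  have hxN : x ∈ N := ⟨hxS, by rw [Set.mem_preimage, hΦx]; exact mem_ball_self hρ⟩
  have hkT : ∀ k : K, k ∈ ball (0 : K) ρ → ((0 : Fin p → ℂ), k) ∈ ball ((0, 0) : (Fin p → ℂ) × K) ρ :=
    fun k hk => by rw [mem_ball, Prod.dist_eq]; simpa using hk
  refine ⟨N, K, ρ, fun k => Ψ (0, k), hNo, hxN, fun z hz => (hU₁N (hSU hz.1)).1, hρ, hdim,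
    ?_, ?_, ?_⟩
  · exact hΨd.comp (by fun_prop) fun k hk => hρT (hkT k hk)
  · intro k hk k' hk' hkk'
    have h1 := (hΨΦ _ (hρT (hkT k hk))).2
    have h2 := (hΨΦ _ (hρT (hkT k' hk'))).2
    simp only at hkk'
    rw [hkk'] at h1
    have := h1.symm.trans h2
    simpa using this
  · ext z
    constructor
    · rintro ⟨k, hk, rfl⟩
      obtain ⟨hzS, hΦz⟩ := hΨΦ _ (hρT (hkT k hk))
      have hgz : g (Ψ (0, k)) = 0 := congrArg Prod.fst hΦz
      refine ⟨(hZU.symm.subset ⟨hU₁U (hSU hzS), hgz⟩).1, hzS, ?_⟩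
      rw [Set.mem_preimage, hΦz]; exact hkT k hk
    · rintro ⟨hzZ, hzS, hzB⟩
      have hgz : g z = 0 := (hZU.subset ⟨hzZ, hU₁U (hSU hzS)⟩).2
      refine ⟨ψ (z - x), ?_, ?_⟩
      · have hle : dist (ψ (z - x)) 0 ≤ max (dist (0 : Fin p → ℂ) 0) (dist (ψ (z - x)) 0) :=
          le_max_right _ _
        rw [Set.mem_preimage, hgz, mem_ball, Prod.dist_eq] at hzB
        rw [mem_ball]
        exact lt_of_le_of_lt hle hzB
      · have := (hΦΨ z hzS).2
        rwa [hgz] at this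

/-- **Regular points are dense** (model-space form of
`Literature.Geometry.Kaehler.IsAnalyticSetAt.inter_regularLocus_nonempty`): a point of `Z` near
which `Z` is cut out by holomorphic equations lies in the closure of the regular locus.
[Chirka, *Complex Analytic Sets*, §2.3] [folklore] -/
theorem mem_closure_regLocus {Z : Set E} {x : E} (hZ : IsZeroSetAt Z x) (hx : x ∈ Z) :
    x ∈ closure (regLocus Z) := by
  rw [_root_.mem_closure_iff]
  intro O hO hxO
  have := (isZeroSetAt_iff_isAnalyticSetAt.1 hZ).inter_regularLocus_nonempty hx hO hxO
  rwa [regularLocus_eq_regLocus] at this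

/-- **The codimension is constant along connected components of the regular locus** (model-space
form of `Literature.Geometry.Kaehler.connectedComponentIn_regularLocus_subset_regularLocusOfCodim`).
[Chirka, *Complex Analytic Sets*, §2.3–2.4] [folklore] -/
theorem isRegPt_of_mem_connectedComponentIn {Z : Set E} {p : ℕ} {q r : E} (hqZ : q ∈ Z)
    (hq : IsRegPt Z p q) (hr : r ∈ connectedComponentIn (regLocus Z) q) : IsRegPt Z p r := by
  have hq' : q ∈ Literature.Geometry.Kaehler.regularLocusOfCodim 𝓘(ℂ, E) Z p :=
    ⟨hqZ, isRegularPointOfCodim_iff_isRegPt.2 hq⟩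
  have h := Literature.Geometry.Kaehler.connectedComponentIn_regularLocus_subset_regularLocusOfCodim hq'
  rw [regularLocus_eq_regLocus] at h
  exact isRegularPointOfCodim_iff_isRegPt.1 (h hr).2

end ModelTools

/-! ### Regular points of the cone -/

section Cone

variable {d m : ℕ} {Z : Set ((Fin d → ℂ) × (Fin (m + 1) → ℂ))} {G : Set (Fin d → ℂ)}

/-- **Points of `Z` over `G` are regular of codimension `m + 1`**: near such a point `Z` is the
graph `w = τ j (z')` of a single holomorphic sheet, cut out by the `m + 1` equations `w - τ j (z') = 0`
with surjective differential. [Chirka, *Complex Analytic Sets*, §2.3, §4.1] [folklore] -/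
theorem isRegPt_of_fst_mem_good
    (hG : ∀ z', z' ∈ G ↔ z' ≠ 0 ∧ ∃ δ > 0, ∃ (k : ℕ) (τ : Fin k → (Fin d → ℂ) → (Fin (m + 1) → ℂ)),
      (∀ j, DifferentiableOn ℂ (τ j) (ball z' δ)) ∧
      (∀ y ∈ ball z' δ, ∀ j j', j ≠ j' → τ j y ≠ τ j' y) ∧
      ∀ y ∈ ball z' δ, ∀ w, (y, w) ∈ Z ↔ ∃ j, w = τ j y)
    {x : (Fin d → ℂ) × (Fin (m + 1) → ℂ)} (hxZ : x ∈ Z) (hxG : x.1 ∈ G) :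
    IsRegPt Z (m + 1) x := by
  classical
  obtain ⟨-, δ, hδ, k, τ, hτd, hτne, hτZ⟩ := (hG x.1).1 hxG
  obtain ⟨j, hj⟩ := (hτZ x.1 (mem_ball_self hδ) x.2).1 (by simpa using hxZ)
  -- separation of the sheet values at `x.1`
  obtain ⟨η, hη, -, hηle⟩ := exists_pos_le_forall (ι := {j' : Fin k // j' ≠ j})
    (g := fun j' => dist (τ j' x.1) (τ j x.1))
    (fun j' => dist_pos.2 (hτne x.1 (mem_ball_self hδ) _ _ j'.2)) one_pos
  -- continuity of the sheets at `x.1`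
  have hcont : ∀ j', ∃ δ' > 0, ∀ y ∈ ball x.1 δ', dist (τ j' y) (τ j' x.1) < η / 2 := by
    intro j'
    have hc : ContinuousAt (τ j') x.1 :=
      (hτd j').continuousOn.continuousAt (isOpen_ball.mem_nhds (mem_ball_self hδ))
    obtain ⟨δ', hδ', h⟩ := Metric.continuousAt_iff.1 hc (η / 2) (by positivity)
    exact ⟨δ', hδ', fun y hy => h hy⟩
  choose δj hδj hδjcont using hcont
  obtain ⟨δ', hδ', hδ'δ, hδ'j⟩ := exists_pos_le_forall (ι := Fin k) (g := δj) hδj hδ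
  set U : Set ((Fin d → ℂ) × (Fin (m + 1) → ℂ)) := ball x.1 δ' ×ˢ ball x.2 (η / 2) with hU
  have hUo : IsOpen U := isOpen_ball.prod isOpen_ball
  have hxU : x ∈ U := mk_mem_prod (mem_ball_self hδ') (mem_ball_self (by positivity))
  have hball : ball x.1 δ' ⊆ ball x.1 δ := ball_subset_ball hδ'δ
  -- the equations `w - τ j z' = 0`
  set g : (Fin d → ℂ) × (Fin (m + 1) → ℂ) → (Fin (m + 1) → ℂ) := fun y => y.2 - τ j y.1 with hg
  have hgd : DifferentiableOn ℂ g U :=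
    differentiableOn_snd.sub ((hτd j).comp differentiableOn_fst fun y hy => hball hy.1)
  refine ⟨U, hUo, hxU, g, hgd, ?_, ?_⟩
  · ext y
    simp only [mem_inter_iff, mem_preimage, mem_singleton_iff, hg, sub_eq_zero]
    constructor
    · rintro ⟨hyZ, hyU⟩
      refine ⟨hyU, ?_⟩
      obtain ⟨j', hj'⟩ := (hτZ y.1 (hball hyU.1) y.2).1 (by simpa using hyZ)
      by_cases hjj : j' = j
      · rw [hj', hjj]
      · exfalso
        have h1 : η ≤ dist (τ j' x.1) (τ j x.1) := hηle ⟨j', hjj⟩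
        have h2 : dist (τ j' y.1) (τ j' x.1) < η / 2 := hδjcont j' y.1 (ball_subset_ball (hδ'j j') hyU.1)
        have h3 : dist y.2 x.2 < η / 2 := hyU.2
        rw [hj', hj] at h3
        have := dist_triangle (τ j' x.1) (τ j' y.1) (τ j x.1)
        rw [dist_comm (τ j' x.1) (τ j' y.1)] at this
        linarith
    · rintro ⟨hyU, hy⟩
      refine ⟨?_, hyU⟩
      have := (hτZ y.1 (hball hyU.1) y.2).2 ⟨j, hy⟩
      simpa using this
  · -- surjectivity of the differential
    have hτj : HasFDerivAt (τ j) (fderiv ℂ (τ j) x.1) x.1 :=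
      ((hτd j).differentiableAt (isOpen_ball.mem_nhds (mem_ball_self hδ))).hasFDerivAt
    have hgder : HasFDerivAt g (ContinuousLinearMap.snd ℂ (Fin d → ℂ) (Fin (m + 1) → ℂ) -
        (fderiv ℂ (τ j) x.1).comp (ContinuousLinearMap.fst ℂ (Fin d → ℂ) (Fin (m + 1) → ℂ))) x :=
      hasFDerivAt_snd.sub (hτj.comp x hasFDerivAt_fst)
    rw [hgder.fderiv]
    intro v
    exact ⟨(0, v), by simp⟩

/-- Points of `Z` other than the vertex have non-zero base coordinate (the fibre space is
isolating). [folklore] -/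
theorem fst_ne_zero_of_mem (hiso : ∀ w, ((0 : Fin d → ℂ), w) ∈ Z → w = 0)
    {x : (Fin d → ℂ) × (Fin (m + 1) → ℂ)} (hxZ : x ∈ Z) (hx0 : x ≠ 0) : x.1 ≠ 0 := by
  intro h1
  apply hx0
  have h2 : x.2 = 0 := hiso x.2 (by rw [← h1]; exact hxZ)
  exact Prod.ext h1 h2

/-- **Key lemma: regular points of codimension `m + 1` of `Z ∖ {0}` lie in `Z₁ = cl (Z ∩ π⁻¹ G)`.**
Near such a point `b`, `Z` is an injectively parametrised `d`-dimensional complex manifold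
(`IsRegPt.exists_param`) on which the projection `π` has finite fibres; by
`exists_map_nhds_eq_of_isolated` the projection is open at some point of any neighbourhood of `b`
in `Z`, so if that neighbourhood avoided `π⁻¹(G)` the discriminant `Δ` of `exists_thin_of_good`
(which vanishes at base points off `G`) would vanish on an open set, contradicting `Δ ≢ 0`.
[cite: Chirka1989, §4.4 (proof of the Remmert–Stein theorem), p. 48] -/
theorem mem_closure_good_of_isRegPt (hcl : IsClosed Z)
    (hcone : ∀ (c : ℂ) (x : (Fin d → ℂ) × (Fin (m + 1) → ℂ)), x ∈ Z → c • x ∈ Z)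
    (han : ∀ x : (Fin d → ℂ) × (Fin (m + 1) → ℂ), x ≠ 0 → IsZeroSetAt Z x)
    (hiso : ∀ w, ((0 : Fin d → ℂ), w) ∈ Z → w = 0)
    (hG : ∀ z', z' ∈ G ↔ z' ≠ 0 ∧ ∃ δ > 0, ∃ (k : ℕ) (τ : Fin k → (Fin d → ℂ) → (Fin (m + 1) → ℂ)),
      (∀ j, DifferentiableOn ℂ (τ j) (ball z' δ)) ∧
      (∀ y ∈ ball z' δ, ∀ j j', j ≠ j' → τ j y ≠ τ j' y) ∧
      ∀ y ∈ ball z' δ, ∀ w, (y, w) ∈ Z ↔ ∃ j, w = τ j y)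
    {b : (Fin d → ℂ) × (Fin (m + 1) → ℂ)} (hbZ : b ∈ Z) (hb0 : b ≠ 0)
    (hreg : IsRegPt (Z ∩ {x | x ≠ 0}) (m + 1) b) :
    b ∈ closure {x : (Fin d → ℂ) × (Fin (m + 1) → ℂ) | x ∈ Z ∧ x.1 ∈ G} := by
  classical
  obtain ⟨C, hC0, hC⟩ := exists_norm_snd_le_mul_norm_fst hcl hcone hiso
  have hb1 : b.1 ≠ 0 := fst_ne_zero_of_mem hiso hbZ hb0
  obtain ⟨ε, hε, Δ, hΔd, hΔne, hgood⟩ := exists_thin_of_good hcl han hC hG hb1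
  by_contra hbcl
  -- a neighbourhood of `b` missing `Z ∩ π⁻¹ G`
  obtain ⟨N₀, hN₀, hN₀T⟩ : ∃ N₀ ∈ 𝓝 b,
      ∀ y ∈ N₀, ¬ (y ∈ Z ∧ y.1 ∈ G) := by
    rw [mem_closure_iff_nhds] at hbcl
    push Not at hbcl
    obtain ⟨t, ht, hte⟩ := hbcl
    refine ⟨t, ht, fun y hy hyT => ?_⟩
    have : y ∈ t ∩ {x | x ∈ Z ∧ x.1 ∈ G} := ⟨hy, hyT⟩
    rw [hte] at this
    exact this
  -- parametrisation of `Z ∖ {0}` near `b`, inside `N₀ ∩ π⁻¹ (ball b.1 ε ∖ {0})`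
  set N₁ : Set ((Fin d → ℂ) × (Fin (m + 1) → ℂ)) :=
    N₀ ∩ Prod.fst ⁻¹' (ball b.1 ε ∩ {z' | z' ≠ 0}) with hN₁
  have hN₁ : N₁ ∈ 𝓝 b := Filter.inter_mem hN₀ (continuous_fst.continuousAt.preimage_mem_nhds
    ((isOpen_ball.inter isOpen_ne).mem_nhds ⟨mem_ball_self hε, hb1⟩))
  obtain ⟨N, K, ρ, Ψ₀, hNo, hbN, hNN₁, hρ, hdim, hΨd, hΨinj, hΨim⟩ :=
    hreg.exists_param ⟨hbZ, hb0⟩ hN₁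
  have hdimK : Module.finrank ℂ K = Module.finrank ℂ (Fin d → ℂ) := by
    have : Module.finrank ℂ ((Fin d → ℂ) × (Fin (m + 1) → ℂ)) = d + (m + 1) := by
      rw [Module.finrank_prod, Module.finrank_fin_fun, Module.finrank_fin_fun]
    rw [this] at hdim
    rw [Module.finrank_fin_fun]
    omega
  -- the projection restricted to the parametrised piece
  set f : K → (Fin d → ℂ) := fun u => (Ψ₀ u).1 with hf
  have hfd : DifferentiableOn ℂ f (ball 0 ρ) := differentiableOn_fst.comp hΨd (mapsTo_univ _ _)
  have hΨmem : ∀ u ∈ ball (0 : K) ρ, Ψ₀ u ∈ Z ∧ Ψ₀ u ≠ 0 ∧ Ψ₀ u ∈ N := fun u hu => by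
    have : Ψ₀ u ∈ (Z ∩ {x | x ≠ 0}) ∩ N := hΨim ▸ mem_image_of_mem Ψ₀ hu
    exact ⟨this.1.1, this.1.2, this.2⟩
  have hfmem : ∀ u ∈ ball (0 : K) ρ, f u ∈ ball b.1 ε ∧ f u ≠ 0 := fun u hu =>
    (hNN₁ (hΨmem u hu).2.2).2
  -- the fibres of `f` in the ball are finite, hence discrete
  have hiso' : ∀ u ∈ ball (0 : K) ρ, ∀ᶠ v in 𝓝[≠] u, f v ≠ f u := by
    intro u hu
    have hfin : {w : Fin (m + 1) → ℂ | (f u, w) ∈ Z}.Finite :=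
      finite_fibre hcl han hC (hfmem u hu).2
    have hA : {v : K | v ∈ ball (0 : K) ρ ∧ f v = f u}.Finite := by
      refine Set.Finite.of_finite_image ?_ (hΨinj.mono fun v hv => hv.1)
      refine (hfin.image fun w => ((f u, w) : (Fin d → ℂ) × (Fin (m + 1) → ℂ))).subset ?_
      rintro _ ⟨v, ⟨hv, hfv⟩, rfl⟩
      refine ⟨(Ψ₀ v).2, ?_, ?_⟩
      · show (f u, (Ψ₀ v).2) ∈ Z
        rw [← hfv]; exact (hΨmem v hv).1
      · rw [← hfv]
    have hcl' : IsClosed ({v : K | v ∈ ball (0 : K) ρ ∧ f v = f u} \ {u}) :=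
      (hA.subset Set.sdiff_subset).isClosed
    have h1 : ({v : K | v ∈ ball (0 : K) ρ ∧ f v = f u} \ {u})ᶜ ∈ 𝓝 u :=
      hcl'.isOpen_compl.mem_nhds fun h => h.2 rfl
    filter_upwards [mem_nhdsWithin_of_mem_nhds h1, mem_nhdsWithin_of_mem_nhds
      (isOpen_ball.mem_nhds hu), self_mem_nhdsWithin] with v hv1 hv2 hv3 hfv
    exact hv1 ⟨⟨hv2, hfv⟩, hv3⟩
  -- `f` is open at some point of the ball
  obtain ⟨u, hu, hmap⟩ :=
    exists_map_nhds_eq_of_isolated hdimK isOpen_ball ⟨0, mem_ball_self hρ⟩ hfd hiso'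
  have himg : f '' ball 0 ρ ∈ 𝓝 (f u) := by
    rw [← hmap]; exact image_mem_map (isOpen_ball.mem_nhds hu)
  -- `Δ` vanishes at the base points of the piece (they are off `G`), hence near `f u`
  have hΔ0 : ∀ v ∈ ball (0 : K) ρ, Δ (f v) = 0 := by
    intro v hv
    by_contra hne
    have hvG : f v ∈ G := hgood (f v) (hfmem v hv).1 (hfmem v hv).2 hne
    exact hN₀T (Ψ₀ v) (hNN₁ (hΨmem v hv).2.2).1 ⟨(hΨmem v hv).1, hvG⟩
  have hev : Δ =ᶠ[𝓝 (f u)] 0 := by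
    filter_upwards [himg] with z hz
    obtain ⟨v, hv, rfl⟩ := hz
    exact hΔ0 v hv
  exact hΔne (f u) (hfmem u hu).1 hev

/-! ### The decomposition -/

/-- **Decomposition of the cone** (the Remmert–Stein step, combinatorial part). Let
`Z₁ = cl {x ∈ Z | π x ∈ G}`. There is a closed cone `Z₂ ⊆ Z`, cut out by holomorphic equations
near every point `≠ 0`, all of whose points lie over the complement of `G`, with `Z ⊆ Z₁ ∪ Z₂`.
Construction: `Z₂ = cl S₂ ∪ {0}`, `S₂` the union of the connected components of the regular locus of
`Z ∖ {0}` not meeting `π⁻¹(G)` (analytic off the vertex by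
`Literature.Geometry.Kaehler.SCV.RegData.isZeroSetAt_closure`, Chirka §5.1 Thm. (2)); the other
components consist of regular points of codimension `m + 1` (`isRegPt_of_fst_mem_good`,
`isRegPt_of_mem_connectedComponentIn`) and lie in `Z₁` (`mem_closure_good_of_isRegPt`); regular
points are dense (`mem_closure_regLocus`). [cite: Chirka1989, §4.4 Cor. and §5.1 Thm., pp. 48–53] -/
theorem exists_cone_decomposition (hcl : IsClosed Z)
    (hcone : ∀ (c : ℂ) (x : (Fin d → ℂ) × (Fin (m + 1) → ℂ)), x ∈ Z → c • x ∈ Z)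
    (han : ∀ x : (Fin d → ℂ) × (Fin (m + 1) → ℂ), x ≠ 0 → IsZeroSetAt Z x)
    (hiso : ∀ w, ((0 : Fin d → ℂ), w) ∈ Z → w = 0)
    (hG : ∀ z', z' ∈ G ↔ z' ≠ 0 ∧ ∃ δ > 0, ∃ (k : ℕ) (τ : Fin k → (Fin d → ℂ) → (Fin (m + 1) → ℂ)),
      (∀ j, DifferentiableOn ℂ (τ j) (ball z' δ)) ∧
      (∀ y ∈ ball z' δ, ∀ j j', j ≠ j' → τ j y ≠ τ j' y) ∧
      ∀ y ∈ ball z' δ, ∀ w, (y, w) ∈ Z ↔ ∃ j, w = τ j y)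
    (h0 : (0 : (Fin d → ℂ) × (Fin (m + 1) → ℂ)) ∈ Z) :
    ∃ Z₂ : Set ((Fin d → ℂ) × (Fin (m + 1) → ℂ)), IsClosed Z₂ ∧
      (∀ (c : ℂ) (x : (Fin d → ℂ) × (Fin (m + 1) → ℂ)), x ∈ Z₂ → c • x ∈ Z₂) ∧
      (∀ x : (Fin d → ℂ) × (Fin (m + 1) → ℂ), x ≠ 0 → IsZeroSetAt Z₂ x) ∧ Z₂ ⊆ Z ∧
      (∀ x ∈ Z₂, x.1 ∉ G) ∧
      Z ⊆ closure {x : (Fin d → ℂ) × (Fin (m + 1) → ℂ) | x ∈ Z ∧ x.1 ∈ G} ∪ Z₂ := by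
  classical
  -- the punctured cone and its regular locus
  set W : Set ((Fin d → ℂ) × (Fin (m + 1) → ℂ)) := {x | x ≠ 0} with hW
  set Z' : Set ((Fin d → ℂ) × (Fin (m + 1) → ℂ)) := Z ∩ W with hZ'
  set R : Set ((Fin d → ℂ) × (Fin (m + 1) → ℂ)) := regLocus Z' with hR
  have hWo : IsOpen W := isOpen_ne
  have hZ'W : Z' ⊆ W := inter_subset_right
  have hrel : ∀ x ∈ W, x ∈ closure Z' → x ∈ Z' := fun x hxW hx =>
    ⟨hcl.closure_subset (closure_mono inter_subset_left hx), hxW⟩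
  have hanZ' : ∀ x ∈ W, IsZeroSetAt Z' x := fun x hx =>
    (han x hx).congr hWo hx (by rw [hZ', inter_assoc, inter_self])
  -- the components not meeting `π⁻¹ G`
  set J : Set ((Fin d → ℂ) × (Fin (m + 1) → ℂ)) :=
    {y | y ∈ R ∧ ∀ x ∈ connectedComponentIn R y, x.1 ∉ G} with hJ
  set S₂ : Set ((Fin d → ℂ) × (Fin (m + 1) → ℂ)) := ⋃ y ∈ J, connectedComponentIn R y with hS₂
  have hRD : RegData W Z' S₂ := RegData.of_biUnion hWo hZ'W hrel hanZ' J
  have hS₂G : ∀ x ∈ S₂, x.1 ∉ G := by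
    intro x hx
    obtain ⟨y, hyJ, hxy⟩ : ∃ y ∈ J, x ∈ connectedComponentIn R y := by
      simpa only [hS₂, mem_iUnion, exists_prop] using hx
    exact hyJ.2 x hxy
  have hclS₂G : ∀ x ∈ closure S₂, x.1 ∉ G := by
    have hclosed : IsClosed {x : (Fin d → ℂ) × (Fin (m + 1) → ℂ) | x.1 ∉ G} := by
      have : {x : (Fin d → ℂ) × (Fin (m + 1) → ℂ) | x.1 ∉ G} = Prod.fst ⁻¹' Gᶜ := rfl
      rw [this]
      exact (isOpen_of_good hG).isClosed_compl.preimage continuous_fst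
    exact fun x hx => (hclosed.closure_subset_iff.2 hS₂G) hx
  -- `S₂` is stable under non-zero scalars
  have hS₂smul : ∀ (c : ℂ), c ≠ 0 → ∀ x ∈ S₂, c • x ∈ S₂ := by
    intro c hc x hx
    set Θ : ((Fin d → ℂ) × (Fin (m + 1) → ℂ)) ≃L[ℂ] ((Fin d → ℂ) × (Fin (m + 1) → ℂ)) :=
      (LinearEquiv.smulOfNeZero ℂ _ c hc).toContinuousLinearEquiv with hΘ
    have hΘapply : ∀ y, Θ y = c • y := fun y => by simp [hΘ]
    -- `Θ` preserves `Z'` and hence the regular locus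
    have hΘZ' : Θ '' Z' = Z' := by
      apply Subset.antisymm
      · rintro _ ⟨y, hy, rfl⟩
        rw [hΘapply]
        exact ⟨hcone c y hy.1, smul_ne_zero hc hy.2⟩
      · intro y hy
        refine ⟨c⁻¹ • y, ⟨hcone c⁻¹ y hy.1, smul_ne_zero (inv_ne_zero hc) hy.2⟩, ?_⟩
        rw [hΘapply, smul_smul, mul_inv_cancel₀ hc, one_smul]
    have hΘR : Θ '' R = R := by
      rw [hR, ← regLocus_image_equiv Θ Z', hΘZ']
    obtain ⟨y, hyJ, hxy⟩ : ∃ y ∈ J, x ∈ connectedComponentIn R y := by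
      simpa only [hS₂, mem_iUnion, exists_prop] using hx
    have hyR : y ∈ R := hyJ.1
    have hcomp : Θ '' connectedComponentIn R y = connectedComponentIn R (Θ y) := by
      have := Θ.toHomeomorph.image_connectedComponentIn (s := R) hyR
      rw [ContinuousLinearEquiv.coe_toHomeomorph, hΘR] at this
      exact this
    have hΘyJ : Θ y ∈ J := by
      refine ⟨hΘR ▸ mem_image_of_mem Θ hyR, fun x' hx' hx'G => ?_⟩
      rw [← hcomp] at hx'
      obtain ⟨x'', hx'', rfl⟩ := hx'
      refine hyJ.2 x'' hx'' ?_
      have : (Θ x'').1 = c • x''.1 := by rw [hΘapply, Prod.smul_fst]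
      rw [this] at hx'G
      have := smul_mem_of_good hcone hG (inv_ne_zero hc) hx'G
      rwa [smul_smul, inv_mul_cancel₀ hc, one_smul] at this
    have hmem : Θ x ∈ connectedComponentIn R (Θ y) := hcomp ▸ mem_image_of_mem Θ hxy
    rw [hΘapply] at hmem
    simpa only [hS₂, mem_iUnion, exists_prop] using ⟨Θ y, hΘyJ, hmem⟩
  refine ⟨closure S₂ ∪ {0}, isClosed_closure.union isClosed_singleton, ?_, ?_, ?_, ?_, ?_⟩
  · -- cone
    intro c x hx
    by_cases hc : c = 0
    · subst hc; rw [zero_smul]; exact Or.inr rfl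
    rcases hx with hx | hx
    · left
      exact map_mem_closure (continuous_const_smul c) hx fun y hy => hS₂smul c hc y hy
    · rw [mem_singleton_iff] at hx
      rw [hx, smul_zero]; exact Or.inr rfl
  · -- analytic off the vertex
    intro x hx
    refine (hRD.isZeroSetAt_closure hx).union
      (Literature.Analysis.Complex.SCV.IsZeroSetAt.of_notMem_closure ?_)
    rwa [closure_singleton, mem_singleton_iff]
  · -- contained in `Z`
    rintro x (hx | hx)
    · exact hcl.closure_subset (closure_mono hRD.S_subset_Z hx |> closure_mono inter_subset_left)
    · rw [mem_singleton_iff] at hx; rw [hx]; exact h0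
  · -- over the complement of `G`
    rintro x (hx | hx)
    · exact hclS₂G x hx
    · rw [mem_singleton_iff] at hx
      rw [hx]
      exact fun h => ((hG 0).1 h).1 rfl
  · -- `Z ⊆ Z₁ ∪ Z₂`
    intro x hxZ
    by_cases hx0 : x = 0
    · exact Or.inr (Or.inr hx0)
    have hxZ' : x ∈ Z' := ⟨hxZ, hx0⟩
    have hxcl : x ∈ closure R := mem_closure_regLocus (hanZ' x hx0) hxZ'
    -- `R ⊆ Z₁ ∪ S₂`
    have hRsub : R ⊆ closure {x | x ∈ Z ∧ x.1 ∈ G} ∪ S₂ := by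
      intro r hr
      by_cases hC : ∀ x' ∈ connectedComponentIn R r, x'.1 ∉ G
      · right
        have hrJ : r ∈ J := ⟨hr, hC⟩
        simpa only [hS₂, mem_iUnion, exists_prop] using ⟨r, hrJ, mem_connectedComponentIn hr⟩
      · left
        push Not at hC
        obtain ⟨q, hq, hqG⟩ := hC
        have hqR : q ∈ R := connectedComponentIn_subset _ _ hq
        have hqZ' : q ∈ Z' := hqR.1
        -- `q`, hence `r`, is regular of codimension `m + 1`
        have hqreg : IsRegPt Z' (m + 1) q :=
          (isRegPt_of_fst_mem_good hG hqZ'.1 hqG).congr hWo hqZ'.2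
            (by rw [hZ', inter_assoc, inter_self])
        have hrq : r ∈ connectedComponentIn R q := by
          rw [← connectedComponentIn_eq hq]; exact mem_connectedComponentIn hr
        have hrreg : IsRegPt Z' (m + 1) r := isRegPt_of_mem_connectedComponentIn hqZ' hqreg hrq
        exact mem_closure_good_of_isRegPt hcl hcone han hiso hG hr.1.1 hr.1.2 hrreg
    have := closure_mono hRsub hxcl
    rw [closure_union, closure_closure] at this
    rcases this with h | h
    · exact Or.inl h
    · exact Or.inr (Or.inl h)

end Cone

end Literature.AlgebraicGeometry.Motives

end
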